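import Mathlib.MeasureTheory.Integral.IntegralEqImproper
import Mathlib.MeasureTheory.Integral.Prod
import Mathlib.MeasureTheory.Integral.IntervalIntegral.FundThmCalculus
import Literature.Analysis.FluidPDE.ElgindiLinearizedOperator
import HarnessLib

/-!
# Calculus of Elgindi's operator `L₁₂` on test functions of the quarter strip:
`(L₁₂f)' = −z⁻¹∫K f dθ` and `L₁₂(z∂_z f) = z∂_z L₁₂(f)`

Topic `Literature/Analysis/FluidPDE`. Support file (one auxiliary definition with its proved API,
**no named facts**) on the proof path of the named fact
`Literature.Analysis.FluidPDE.Elgindi.ElgindiGhoulMasmoudi2021_stabilityCore`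
(`ElgindiStabilityDecomposition.lean`), continuing `ElgindiLinearizedOperator.lean`: the
one-variable calculus of `L₁₂(f)(z) = ∫_z^∞ ∫₀^{π/2} f(r,θ)K(θ)/r dθ dr` (`Elgindi.L12`,
`ElgindiFundamentalModel.lean`; T. M. Elgindi, Ann. of Math. 194 (2021) = arXiv:1904.04795,
§1.7.2, and Elgindi–Ghoul–Masmoudi, Camb. J. Math. 9 (2021) = arXiv:1910.14071, Def. 1.7) that
both papers use silently and that enters the proofs of [Elgindi2021] Lemma 5.3 (L12L)
("`L₁₂(f + z∂_z f − …) = L₁₂(f) + z∂_z L₁₂(f) − …`", p. 15), Lemma 5.4 ("`= (2/3)∫ z⁻⁴L₁₂(f)(z)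
∫₀^{π/2} K(θ)f(z,θ) dθ dz`", i.e. `∂_z L₁₂(f) = −z⁻¹∫K f dθ`) and Prop. 5.5 ("the definition of
`L₁₂` in the third equality": `−2(K f w/z, L₁₂f) = (∂_z(L₁₂(f)²), w)`).

## Contents (all for `f` continuous, resp. `C¹`, with compact support inside the open strip)

* `Elgindi.kMoment f z = ∫₀^{π/2} f(z,θ)K(θ) dθ`, the angular `K`-moment; `L₁₂(f)(z) =
  ∫_{r>z} kMoment f r / r dr` (`L12_eq_integral_kMoment_div`, unconditional);
* the support of a test function projects into some `[a, b] ⊂ (0, ∞)`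
  (`exists_radial_bounds`); `kMoment f` is continuous with support in `[a, b]`, and so is
  `r ↦ kMoment f r / r` (`continuous_kMoment_div`);
* **`L₁₂(f)` is an interval integral** `∫_z^b` of that function (`L12_eq_intervalIntegral`), hence
  **`(L₁₂f)'(z) = −kMoment f z / z` at every `z`** (`hasDerivAt_L12`), `L₁₂(f)` is constant
  (`= L₁₂(f)(0)`) below the support and `0` above it (`L12_eq_L12_zero_of_le`,
  `L12_eq_zero_of_le`);
* **`L₁₂(z∂_z f)(z) = −kMoment f z = z (L₁₂f)'(z)`** (`L12_Dz`, `L12_Dz_eq_mul_deriv`): Fubini on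
  `(z, ∞) × (0, π/2)` and `∫_z^∞ ∂_r f(r,θ) dr = −f(z,θ)`.

## What is NOT here

The commutation identity (L12L) `L₁₂(𝓛_Γ f) = 𝓛(L₁₂ f)` itself ([Elgindi2021] Lemma 5.3), the
Hardy-type inequality of Lemma 5.4 and Prop. 5.5 — next files. Used from Mathlib:
`continuous_parametric_integral_of_continuous`, `intervalIntegral.integral_hasDerivAt_left`,
`integral_Ioi_of_hasDerivAt_of_tendsto`, `integral_integral_swap`, `IsCompact.exists_isLeast`.
-/

noncomputable section

open MeasureTheory Set Function Real Filter
open _root_.Topology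

namespace Literature.Analysis.FluidPDE

namespace Elgindi

/-! ### The angular `K`-moment and `L₁₂` -/

/-- The angular `K`-moment `∫₀^{π/2} f(z, θ) K(θ) dθ` of a function on the strip, so that
`L₁₂(f)(z) = ∫_z^∞ (K-moment)(r) dr/r` (Elgindi 2021, §1.7.2: "`L₁₂(f)(z) = ∫_z^∞∫₀^{π/2}
f(r,θ)K(θ)/r dr dθ`"; the inner integral "`∫₀^{π/2} K(θ)f(z,θ)dθ`" of the proof of Lemma 5.4). [cite: Elgindi2021, §1.7.2 (p. 7 of arXiv:1904.04795) and §5 Lemma 5.4, proof (p. 15)] -/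
def kMoment (f : ℝ → ℝ → ℝ) (z : ℝ) : ℝ :=
  ∫ θ in Ioo 0 (π / 2), f z θ * kernelK θ

/-- Unfolding `kMoment`. [folklore] -/
theorem kMoment_def (f : ℝ → ℝ → ℝ) (z : ℝ) :
    kMoment f z = ∫ θ in Ioo 0 (π / 2), f z θ * kernelK θ := rfl

/-- **`L₁₂(f)(z) = ∫_{r > z} (∫₀^{π/2} f(r,θ)K(θ) dθ) dr/r`** (pull `1/r` out of the inner
integral; unconditional). [cite: Elgindi2021, §1.7.2 (p. 7 of arXiv:1904.04795): the definition of L₁₂] -/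
theorem L12_eq_integral_kMoment_div (f : ℝ → ℝ → ℝ) (z : ℝ) :
    L12 f z = ∫ r in Ioi z, kMoment f r / r := by
  rw [L12_def]
  congr 1
  funext r
  rw [kMoment_def, ← MeasureTheory.integral_div]

/-- If `f(z, ·) ≡ 0` then the `K`-moment vanishes at `z`. [folklore] -/
theorem kMoment_eq_zero_of_forall {f : ℝ → ℝ → ℝ} {z : ℝ} (h : ∀ θ, f z θ = 0) :
    kMoment f z = 0 := by
  simp [kMoment_def, h]

/-! ### Test functions of the strip: radial bounds of the support -/

/-- The support of a compactly supported function of the open quarter strip projects into a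
compact interval `[a, b] ⊂ (0, ∞)` of the radial variable. [folklore] -/
theorem exists_radial_bounds {F : ℝ × ℝ → ℝ} (hs : HasCompactSupport F) (hsub : tsupport F ⊆ strip) :
    ∃ a b : ℝ, 0 < a ∧ a ≤ b ∧ ∀ p, F p ≠ 0 → a ≤ p.1 ∧ p.1 ≤ b := by
  set K : Set ℝ := Prod.fst '' tsupport F with hK
  have hKc : IsCompact K := hs.image continuous_fst
  rcases K.eq_empty_or_nonempty with hKe | hKne
  · refine ⟨1, 1, one_pos, le_rfl, fun p hp => ?_⟩
    have : p.1 ∈ K := ⟨p, subset_tsupport F hp, rfl⟩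
    rw [hKe] at this
    exact this.elim
  · obtain ⟨a, ha, hal⟩ := hKc.exists_isLeast hKne
    obtain ⟨b, hb, hbg⟩ := hKc.exists_isGreatest hKne
    obtain ⟨q, hq, rfl⟩ := ha
    refine ⟨q.1, b, (hsub hq).1, hbg ⟨q, hq, rfl⟩, fun p hp => ?_⟩
    have hpK : p.1 ∈ K := ⟨p, subset_tsupport F hp, rfl⟩
    exact ⟨hal hpK, hbg hpK⟩

/-- **Radial bounds of a test function**, curried form: there are `0 < a ≤ b` with `f(z, θ) = 0`
unless `a ≤ z ≤ b`. [folklore] -/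
theorem exists_radial_bounds' {f : ℝ → ℝ → ℝ} (hs : HasCompactSupport (uncurry f))
    (hsub : tsupport (uncurry f) ⊆ strip) :
    ∃ a b : ℝ, 0 < a ∧ a ≤ b ∧ ∀ z θ, f z θ ≠ 0 → a ≤ z ∧ z ≤ b := by
  obtain ⟨a, b, ha, hab, h⟩ := exists_radial_bounds hs hsub
  exact ⟨a, b, ha, hab, fun z θ hz => h (z, θ) hz⟩

/-! ### Continuity and support of the `K`-moment -/

/-- The `K`-moment of a continuous compactly supported function is continuous (a parametric
integral of a continuous integrand over the compact interval `[0, π/2]`). [folklore] -/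
theorem continuous_kMoment {f : ℝ → ℝ → ℝ} (hf : Continuous (uncurry f)) : Continuous (kMoment f) := by
  have e : kMoment f = fun z => ∫ θ in Icc 0 (π / 2), f z θ * kernelK θ := by
    funext z
    rw [kMoment_def, integral_Icc_eq_integral_Ioo]
  rw [e]
  have hc : Continuous (uncurry fun z θ => f z θ * kernelK θ) :=
    hf.mul (continuous_kernelK.comp continuous_snd)
  exact continuous_parametric_integral_of_continuous hc isCompact_Icc

/-- The function `r ↦ kMoment f r / r` of a test function of the strip is continuous on `ℝ` and
vanishes outside the radial bounds `[a, b]` of the support (in particular near `r = 0`). [folklore] -/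
theorem continuous_kMoment_div {f : ℝ → ℝ → ℝ} (hf : Continuous (uncurry f)) {a b : ℝ} (ha : 0 < a)
    (hab : ∀ z θ, f z θ ≠ 0 → a ≤ z ∧ z ≤ b) :
    Continuous fun r => kMoment f r / r := by
  have hk := continuous_kMoment hf
  refine continuous_iff_continuousAt.2 fun r => ?_
  by_cases hr : r = 0
  · -- near `0` (indeed for `r < a`) the moment vanishes identically
    have h0 : (fun r => kMoment f r / r) =ᶠ[𝓝 r] fun _ => 0 := by
      have : Iio a ∈ 𝓝 r := Iio_mem_nhds (by rw [hr]; exact ha)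
      filter_upwards [this] with s hs
      rw [kMoment_eq_zero_of_forall fun θ => ?_, zero_div]
      by_contra h
      exact (not_le.2 (mem_Iio.1 hs)) (hab s θ h).1
    exact h0.continuousAt
  · exact (hk.continuousAt).div continuousAt_id hr

/-- Outside `[a, b]` the `K`-moment of a test function vanishes. [folklore] -/
theorem kMoment_eq_zero_of_not_mem {f : ℝ → ℝ → ℝ} {a b : ℝ}
    (hab : ∀ z θ, f z θ ≠ 0 → a ≤ z ∧ z ≤ b) {r : ℝ} (hr : r < a ∨ b < r) : kMoment f r = 0 := by
  refine kMoment_eq_zero_of_forall fun θ => ?_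
  by_contra h
  rcases hr with hr | hr
  · exact (not_le.2 hr) (hab r θ h).1
  · exact (not_le.2 hr) (hab r θ h).2

/-! ### `L₁₂(f)` as an interval integral; its derivative -/

/-- **`L₁₂(f)(z) = ∫_z^b kMoment f r / r dr`** for a test function with radial support in `[a, b]`
(for every real `z`; both sides vanish for `z ≥ b`). [folklore] -/
theorem L12_eq_intervalIntegral {f : ℝ → ℝ → ℝ} (hf : Continuous (uncurry f)) {a b : ℝ} (ha : 0 < a)
    (hab : ∀ z θ, f z θ ≠ 0 → a ≤ z ∧ z ≤ b) (z : ℝ) :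
    L12 f z = ∫ r in z..b, kMoment f r / r := by
  have hψ := continuous_kMoment_div hf ha hab
  have hzero : ∀ r, b < r → kMoment f r / r = 0 := fun r hr => by
    rw [kMoment_eq_zero_of_not_mem hab (Or.inr hr), zero_div]
  rw [L12_eq_integral_kMoment_div]
  rcases le_or_gt z b with hzb | hzb
  · rw [intervalIntegral.integral_of_le hzb]
    refine (setIntegral_eq_of_subset_of_forall_sdiff_eq_zero measurableSet_Ioi
      Ioc_subset_Ioi_self fun r hr => hzero r ?_)
    simp only [Set.mem_sdiff, mem_Ioi, mem_Ioc, not_and, not_le] at hr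
    exact hr.2 hr.1
  · rw [intervalIntegral.integral_of_ge hzb.le,
      setIntegral_eq_zero_of_forall_eq_zero (fun r (hr : r ∈ Ioi z) => hzero r (hzb.trans hr)),
      setIntegral_eq_zero_of_forall_eq_zero (fun r (hr : r ∈ Ioc b z) => hzero r hr.1), neg_zero]

/-- **`(L₁₂f)'(z) = −(∫₀^{π/2} f(z,θ)K(θ) dθ)/z` at every `z`**, for a continuous test function of
the strip (the fundamental theorem of calculus at the lower limit; the identity behind "the
definition of `L₁₂`" steps in [Elgindi2021] §5, e.g. `∂_z L₁₂(f) · z = −∫K f dθ` in the proof of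
Lemma 5.4). [cite: Elgindi2021, §5 Lemma 5.4, proof (p. 15 of arXiv:1904.04795)] -/
theorem hasDerivAt_L12 {f : ℝ → ℝ → ℝ} (hf : Continuous (uncurry f))
    (hs : HasCompactSupport (uncurry f)) (hsub : tsupport (uncurry f) ⊆ strip) (z : ℝ) :
    HasDerivAt (L12 f) (-(kMoment f z / z)) z := by
  obtain ⟨a, b, ha, -, hab⟩ := exists_radial_bounds' hs hsub
  have hψ := continuous_kMoment_div hf ha hab
  have e : L12 f = fun u => ∫ r in u..b, kMoment f r / r :=
    funext fun u => L12_eq_intervalIntegral hf ha hab u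
  rw [e]
  exact intervalIntegral.integral_hasDerivAt_left (hψ.intervalIntegrable _ _)
    (hψ.stronglyMeasurableAtFilter _ _) hψ.continuousAt

/-- `(L₁₂f)' = −kMoment f / z`, `deriv` form. [folklore] -/
theorem deriv_L12 {f : ℝ → ℝ → ℝ} (hf : Continuous (uncurry f))
    (hs : HasCompactSupport (uncurry f)) (hsub : tsupport (uncurry f) ⊆ strip) (z : ℝ) :
    deriv (L12 f) z = -(kMoment f z / z) :=
  (hasDerivAt_L12 hf hs hsub z).deriv

/-- `L₁₂(f)` of a test function is continuous. [folklore] -/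
theorem continuous_L12 {f : ℝ → ℝ → ℝ} (hf : Continuous (uncurry f))
    (hs : HasCompactSupport (uncurry f)) (hsub : tsupport (uncurry f) ⊆ strip) :
    Continuous (L12 f) :=
  continuous_iff_continuousAt.2 fun z => (hasDerivAt_L12 hf hs hsub z).continuousAt

/-- Above the radial support `L₁₂(f)` vanishes: `L₁₂(f)(z) = 0` for `z ≥ b`. [folklore] -/
theorem L12_eq_zero_of_le {f : ℝ → ℝ → ℝ} (hf : Continuous (uncurry f)) {a b : ℝ} (ha : 0 < a)
    (hab : ∀ z θ, f z θ ≠ 0 → a ≤ z ∧ z ≤ b) {z : ℝ} (hz : b ≤ z) : L12 f z = 0 := by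
  rw [L12_eq_intervalIntegral hf ha hab z, intervalIntegral.integral_of_ge hz,
    setIntegral_eq_zero_of_forall_eq_zero (fun r (hr : r ∈ Ioc b z) => ?_), neg_zero]
  rw [kMoment_eq_zero_of_not_mem hab (Or.inr hr.1), zero_div]

/-- Below the radial support `L₁₂(f)` is constant: `L₁₂(f)(z) = L₁₂(f)(0)` for `z ≤ a`. [folklore] -/
theorem L12_eq_L12_zero_of_le {f : ℝ → ℝ → ℝ} (hf : Continuous (uncurry f)) {a b : ℝ} (ha : 0 < a)
    (hab : ∀ z θ, f z θ ≠ 0 → a ≤ z ∧ z ≤ b) {z : ℝ} (hz : z ≤ a) : L12 f z = L12 f 0 := by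
  have hψ := continuous_kMoment_div hf ha hab
  rw [L12_eq_intervalIntegral hf ha hab z, L12_eq_intervalIntegral hf ha hab 0,
    ← intervalIntegral.integral_add_adjacent_intervals (b := 0) (hψ.intervalIntegrable _ _)
      (hψ.intervalIntegrable _ _)]
  suffices h0 : ∫ r in z..0, kMoment f r / r = 0 by rw [h0, zero_add]
  have hne : ∀ᵐ r : ℝ, r ≠ a := (ae_iff (μ := volume)).2 (by simp)
  refine intervalIntegral.integral_zero_ae (hne.mono fun r hr hmem => ?_)
  have hr' : r < a := by
    rcases le_or_gt z 0 with hz0 | hz0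
    · rw [uIoc_of_le hz0] at hmem
      exact lt_of_le_of_lt hmem.2 ha
    · rw [uIoc_of_ge hz0.le] at hmem
      exact lt_of_le_of_ne (hmem.2.trans hz) hr
  rw [kMoment_eq_zero_of_not_mem hab (Or.inl hr'), zero_div]

/-! ### `L₁₂(z∂_z f) = z∂_z L₁₂(f)` -/

/-- The partial derivative `∂_z f` of a `C¹` test function of the strip is continuous with compact
support inside the strip. [folklore] -/
theorem continuous_dz {f : ℝ → ℝ → ℝ} (hf : ContDiff ℝ 1 (uncurry f)) : Continuous (uncurry (dz f)) := by
  have hder : ∀ p : ℝ × ℝ, uncurry (dz f) p = fderiv ℝ (uncurry f) p (1, 0) := fun p =>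
    dz_eq_fderiv ((hf.differentiable (by norm_num)) p)
  have hDc : Continuous fun p : ℝ × ℝ => fderiv ℝ (uncurry f) p (1, 0) :=
    (hf.continuous_fderiv one_ne_zero).clm_apply continuous_const
  exact hDc.congr fun p => (hder p).symm

/-- `∂_z f` is supported inside the support of `f`. [folklore] -/
theorem tsupport_dz_subset {f : ℝ → ℝ → ℝ} : tsupport (uncurry (dz f)) ⊆ tsupport (uncurry f) := by
  refine closure_minimal (fun p hp => ?_) (isClosed_tsupport _)
  by_contra h
  exact hp (deriv_slice_fst_eq_zero_of_notMem_tsupport (F := uncurry f) h)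

/-- `∂_z f` of a compactly supported `f` is compactly supported. [folklore] -/
theorem hasCompactSupport_dz {f : ℝ → ℝ → ℝ} (hs : HasCompactSupport (uncurry f)) :
    HasCompactSupport (uncurry (dz f)) :=
  hs.mono' ((subset_tsupport _).trans tsupport_dz_subset)

/-- **`L₁₂(z∂_z f)(z) = −∫₀^{π/2} f(z,θ)K(θ) dθ`** for a compactly supported `C¹` function and
every real `z`: by Fubini, `L₁₂(z∂_z f)(z) = ∫₀^{π/2} K(θ) ∫_z^∞ ∂_r f(r,θ) dr dθ = −∫₀^{π/2} K(θ)f(z,θ) dθ`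
(the step "`L₁₂(f + z∂_z f − …) = L₁₂(f) + z∂_zL₁₂(f) − …`" of the proof of Lemma 5.3). [cite: Elgindi2021, §5 Lemma 5.3, proof of (L12L) (p. 15 of arXiv:1904.04795)] -/
theorem L12_Dz {f : ℝ → ℝ → ℝ} (hf : ContDiff ℝ 1 (uncurry f)) (hs : HasCompactSupport (uncurry f))
    (z : ℝ) : L12 (Dz f) z = -kMoment f z := by
  have hfc : Continuous (uncurry f) := hf.continuous
  have hdc : Continuous (uncurry (dz f)) := continuous_dz hf
  have hds : HasCompactSupport (uncurry (dz f)) := hasCompactSupport_dz hs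
  -- the integrand `∂_r f(r,θ) K(θ)` is continuous with compact support, hence integrable
  set G : ℝ × ℝ → ℝ := fun p => dz f p.1 p.2 * kernelK p.2 with hG
  have hGc : Continuous G := hdc.mul (continuous_kernelK.comp continuous_snd)
  have hGs : HasCompactSupport G := hds.mul_right
  have hGi : Integrable G := hGc.integrable_of_hasCompactSupport hGs
  -- Step 1: `L₁₂(z∂_z f)(z) = ∫_{r>z} ∫_θ ∂_r f K` (the factor `r/r` cancels for `r ≠ 0`, a.e.)
  have h1 : L12 (Dz f) z = ∫ r in Ioi z, ∫ θ in Ioo 0 (π / 2), G (r, θ) := by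
    rw [L12_def]
    refine integral_congr_ae ?_
    have : ∀ᵐ r ∂(volume.restrict (Ioi z)), r ≠ 0 :=
      ae_restrict_of_ae ((ae_iff (μ := volume)).2 (by simp))
    filter_upwards [this] with r hr
    congr 1
    funext θ
    simp only [hG, Dz_apply, dz]
    field_simp
  -- Step 2: Fubini, the `r`-integral inside
  have h2 : ∫ r in Ioi z, ∫ θ in Ioo 0 (π / 2), G (r, θ) =
      ∫ θ in Ioo 0 (π / 2), ∫ r in Ioi z, G (r, θ) := by
    refine integral_integral_swap (f := fun r θ => G (r, θ)) ?_
    rw [Measure.prod_restrict]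
    exact hGi.integrableOn
  -- Step 3: `∫_{r>z} ∂_r f(r,θ) dr = −f(z,θ)` for every `θ`
  have h3 : ∀ θ, ∫ r in Ioi z, G (r, θ) = -(f z θ * kernelK θ) := by
    intro θ
    have hsl : ∀ r, HasDerivAt (fun r' => f r' θ * kernelK θ) (G (r, θ)) r := fun r => by
      have hd : HasDerivAt (fun r' => f r' θ) (dz f r θ) r := by
        have hdiff : DifferentiableAt ℝ (uncurry f) (r, θ) := (hf.differentiable (by norm_num)) (r, θ)
        have h := hasDerivAt_slice_fst hdiff
        rw [dz_eq_fderiv (p := (r, θ)) hdiff]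
        exact h
      simpa [hG] using hd.mul_const (kernelK θ)
    have hslc : Continuous fun r' => f r' θ * kernelK θ :=
      (hfc.comp (continuous_id.prodMk continuous_const)).mul continuous_const
    have hsls : HasCompactSupport fun r' => f r' θ * kernelK θ := by
      refine HasCompactSupport.mul_right ?_
      exact HasCompactSupport.of_support_subset_isCompact (hs.image continuous_fst) fun r hr =>
        ⟨(r, θ), subset_tsupport (uncurry f) hr, rfl⟩
    have hlim : Tendsto (fun r' => f r' θ * kernelK θ) atTop (𝓝 0) :=
      hsls.is_zero_at_infty.mono_left atTop_le_cocompact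
    have hGθi : IntegrableOn (fun r => G (r, θ)) (Ioi z) := by
      have hc : Continuous fun r => G (r, θ) := hGc.comp (continuous_id.prodMk continuous_const)
      have hsu : HasCompactSupport fun r => G (r, θ) :=
        HasCompactSupport.of_support_subset_isCompact (hGs.image continuous_fst) fun r hr =>
          ⟨(r, θ), subset_tsupport G hr, rfl⟩
      exact (hc.integrable_of_hasCompactSupport hsu).integrableOn
    rw [integral_Ioi_of_hasDerivAt_of_tendsto hslc.continuousWithinAt (fun r _ => hsl r) hGθi hlim]
    ring
  rw [h1, h2, integral_congr_ae (Eventually.of_forall fun θ => h3 θ), MeasureTheory.integral_neg,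
    kMoment_def]

/-- **`L₁₂(z∂_z f) = z∂_z L₁₂(f)`** pointwise at every `z`, for a `C¹` test function of the strip
(Elgindi 2021, proof of Lemma 5.3: "`L₁₂(f + z∂_z f − 2f/(1+z) − …) = L₁₂(f) + z∂_z L₁₂(f) −
(2/(1+z))L₁₂(f)`", the `z∂_z` term). [cite: Elgindi2021, §5 Lemma 5.3 (L12L), proof (p. 15 of arXiv:1904.04795)] -/
theorem L12_Dz_eq_mul_deriv {f : ℝ → ℝ → ℝ} (hf : ContDiff ℝ 1 (uncurry f))
    (hs : HasCompactSupport (uncurry f)) (hsub : tsupport (uncurry f) ⊆ strip) (z : ℝ) :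
    L12 (Dz f) z = z * deriv (L12 f) z := by
  rw [L12_Dz hf hs z, deriv_L12 hf.continuous hs hsub z]
  by_cases hz : z = 0
  · -- at `z = 0` both sides vanish: the moment is `0` below the (positive) radial support
    obtain ⟨a, b, ha, -, hab⟩ := exists_radial_bounds' hs hsub
    rw [hz, kMoment_eq_zero_of_not_mem hab (Or.inl (by simpa using ha))]
    simp
  · field_simp

end Elgindi

end Literature.Analysis.FluidPDE
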